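import Literature.Geometry.Kaehler.HodgeRiemannPointwise
import Literature.AlgebraicGeometry.Motives.HodgeRiemannBilinearProofs
import Literature.NumberTheory.Transcendental.KaehlerLefschetzHarmonicProofs
import HarnessLib

/-!
# Hodge–Riemann bilinear relations (hodge.S15): the discharge

Theorems-only companion of `Literature/AlgebraicGeometry/Motives/HodgeDecomposition.lean`
discharging its named fact `Literature.AlgebraicGeometry.Motives.hodge_riemann_bilinear`
(**hodge.S15**; Huybrechts (2005), Prop. 3.3.15; Voisin (2002), Thm. 6.32): for a non-zero
`∂̄`-harmonic `(p,q)`-form `α` on a compact connected Kähler manifold, `k = p + q`,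
`k + r = d = dim_ℂ M`, primitive at every point (`α ∧ ω^{r+1} = 0`), the number
`i^{p-q} (-1)^{k(k-1)/2} ∫_M α ∧ ᾱ ∧ ω^r` is real and `> 0`.

The sibling file `HodgeRiemannBilinearProofs.lean` reduced hodge.S15 to the **pointwise
Hodge–Riemann bilinear relation** (Huybrechts (2005), Cor. 1.2.36, printed p. ≈ 40) at the points of
`(M, g)` (`hodge_riemann_bilinear_of_pointwise`), and
`Literature/Geometry/Kaehler/HodgeRiemannPointwise.lean` proves that relation in the
creation/annihilation (CAR) calculus of graded forms on a real inner product space with an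
isometric complex structure and a unitary frame (`Literature.Geometry.Kaehler.hodgeRiemann_frame`).
This file supplies the (bookkeeping) bridge between the two languages at a point `x : M`:

* the tangent space `T_x M` with the metric `g_x` (the `RiemannianBundle` instances), its complex
  structure `J = tangentJ E x` and a unitary frame `u` (`exists_unitaryFrame`);
* `of_kaehlerForm_ofReal`, `of_kaehlerFormPow_ofReal`: the complexified powers `(ω^r)_x ⊗ 1` of
  the Kähler form of a Hermitian metric are `L^r 1` for the CAR Lefschetz operator
  `L = ∑ₐ θₐ ∧ θ'ₐ ∧ ·` of the frame (`kaehlerTwoForm_eq_sum_wedgeOne` and the recursion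
  `ω^{r+1} = ω^r ∧ ω`);
* the values at `x` of the tree's form operations (`MForm.wedge`, `MForm.conj`, `MForm.castDeg`,
  the `ℂ`-action) read in graded forms (`of_wedge_apply`, `of_conj_apply`, `of_castDeg_apply`);
  the rotation hypothesis `α_x(e^{iθ} v) = e^{i(p-q)θ} α_x(v)` is the weight condition
  `HasRotWeight J (p - q)` and pointwise primitivity `(α ∧ ω^{r+1})_x = 0` is `L^{r+1} α_x = 0`;
* `hodgeRiemann_pointwise`: Huybrechts's Cor. 1.2.36 at the points of `(M, g)` in exactly the
  form consumed by `hodge_riemann_bilinear_of_pointwise`, and the closed discharge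
  `hodge_riemann_bilinear_holds : hodge_riemann_bilinear o g`.

No definition and no named fact is introduced.

## References

* D. Huybrechts, *Complex Geometry. An Introduction*, Springer (2005), Cor. 1.2.36 (§1.2,
  printed p. ≈ 40; held `book:huybrechts2005-complex-geometry-introduction` chunk p0053 L21),
  Prop. 3.3.15 (§3.3, printed p. ≈ 139; chunk p0163 L3). [Huybrechts2005]
* C. Voisin, *Hodge Theory and Complex Algebraic Geometry I*, CUP (2002), §3.1.1, Lemma 6.20
  (§6.2.2, printed p. 146; held `book:voisin2002-hodge-theory-complex-algebraic-geometry-i` chunk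
  p0123 L41), Prop. 6.29 (§6.3.1, printed p. 150; chunk p0127 L1), Thm. 6.32 (§6.3.2, printed
  pp. 152–153; chunk p0128 L35). [Voisin2002]
  LOCATOR ERRATUM (2026-08-21): the earlier "(p. 53) / (p. 163) / (pp. 128–129)" were held-text
  CHUNK numbers, not printed pages; see the References block of
  `Literature.AlgebraicGeometry.Motives.HodgeRiemannBilinearProofs` for the table-of-contents
  anchors behind the printed pages given here ("≈" = interpolated, ±1 page).
-/

noncomputable section

open scoped Manifold ContDiff InnerProductSpace
open Bundle Module Finset ContinuousAlternatingMap
open Literature.LinearAlgebra.Alternating Literature.LinearAlgebra.Alternating.GForm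
open Literature.Geometry.Kaehler Literature.NumberTheory.Transcendental

namespace Literature.AlgebraicGeometry.Motives

/-! ### Two small facts of the graded-form calculus -/

section GradedForms

variable {V : Type*} [NormedAddCommGroup V] [NormedSpace ℝ V]
  {A : Type*} [NormedCommRing A] [NormedAlgebra ℝ A]

/-- **`1` is a right unit of the shuffle wedge of graded forms** (`w ∧ 1 = w`; Warner (1983), 2.6,
through the graded commutativity `ContinuousAlternatingMap.WedgeComm_holds` and the left unit
`constOfIsEmpty_one_wedge`). [cite: Warner1983, 2.6] -/
theorem wedgeG_one_right (w : GForm V A) :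
    wedgeG w (of 0 (constOfIsEmpty ℝ V (Fin 0) (1 : A))) = w := by
  funext n
  rw [wedgeG_apply, sum_eq_single (n, 0)]
  · have h : ((n, 0) : ℕ × ℕ).1 + ((n, 0) : ℕ × ℕ).2 = n := Nat.add_zero n
    rw [dif_pos h]
    dsimp only
    rw [of_apply_self, ContinuousAlternatingMap.WedgeComm_holds ℝ V A
      (constOfIsEmpty ℝ V (Fin 0) (1 : A)) (w n), zero_mul, pow_zero, one_smul,
      constOfIsEmpty_one_wedge, domDomCongr_finCongr_trans, domDomCongr_finCongr_trans]
    exact domDomCongr_finCongr_self _ _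
  · rintro ⟨i, j⟩ hij hne
    have h : i + j = n := mem_antidiagonal.1 hij
    rw [dif_pos h]
    have hj : j ≠ 0 := by
      rintro rfl
      rw [Nat.add_zero] at h
      exact hne (by rw [h])
    dsimp only
    rw [of_apply_of_ne hj, ContinuousAlternatingMap.wedge_zero,
      ContinuousAlternatingMap.domDomCongr_zero]
  · intro h
    exact absurd (mem_antidiagonal.2 (Nat.add_zero n)) h

/-- `X ∧ L_S^j Y = L_S^j (X ∧ Y)` for the frame Lefschetz operator. [cite: Warner1983, 2.6] -/
theorem wedgeG_frameLef_pow_right {W : Type*} [NormedAddCommGroup W] [InnerProductSpace ℝ W]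
    (J : W →L[ℝ] W) {d : ℕ} (u : Fin d → W) (S : Finset (Fin d)) (j : ℕ) (X Y : GForm W A) :
    wedgeG X ((frameLef J u S ^ j) Y) = (frameLef J u S ^ j) (wedgeG X Y) :=
  wedgeG_lefG_pow_right _ _ S j X Y

/-- `X ∧ L_S Y = L_S (X ∧ Y)` for the frame Lefschetz operator. [cite: Warner1983, 2.6] -/
theorem wedgeG_frameLef_right {W : Type*} [NormedAddCommGroup W] [InnerProductSpace ℝ W]
    (J : W →L[ℝ] W) {d : ℕ} (u : Fin d → W) (S : Finset (Fin d)) (X Y : GForm W A) :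
    wedgeG X (frameLef J u S Y) = frameLef J u S (wedgeG X Y) :=
  wedgeG_lefG_right _ _ S X Y

end GradedForms

/-! ### The values at a point of the form operations, read in graded forms -/

section Pointwise

variable {E : Type*} [NormedAddCommGroup E] [NormedSpace ℂ E]
  {M : Type*} [TopologicalSpace M] [ChartedSpace E M]
  [RiemannianBundle (fun x : M ↦ TangentSpace 𝓘(ℝ, E) x)] (x : M)

/-- `(β.castDeg h)_x` and `β_x` define the same homogeneous graded form. [folklore] -/
theorem of_castDeg_apply {k k' : ℕ} (h : k = k') (β : MForm 𝓘(ℝ, E) M ℂ k) :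
    of k' (β.castDeg h x) = of k (β x) := by
  subst h; rfl

/-- `(β ∧ γ)_x = β_x ∧ γ_x` in graded forms (the shuffle wedge computed on `T_x M` with the metric
instances is the one computed on the model space, `wedge_tangentSpace`). [folklore] -/
theorem of_wedge_apply {k l : ℕ} (β : MForm 𝓘(ℝ, E) M ℂ k) (γ : MForm 𝓘(ℝ, E) M ℂ l) :
    of (k + l) ((β.wedge γ) x) = wedgeG (of k (β x)) (of l (γ x)) := by
  rw [wedgeG_of_of]
  -- `(β ∧ γ)_x` unfolds to the model-space wedge, which agrees with the tangent-space one
  -- (`wedge_tangentSpace`) definitionally up to the instance path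
  congr 1

/-- `(β̄)_x = conj (β_x)` in graded forms. [folklore] -/
theorem of_conj_apply {k : ℕ} (β : MForm 𝓘(ℝ, E) M ℂ k) : of k (β.conj x) = conjG (of k (β x)) := by
  rw [conjG_of]; rfl

variable [FiniteDimensional ℂ E] {d : ℕ} (u : Fin d → TangentSpace 𝓘(ℝ, E) x)
  (hd : finrank ℝ (TangentSpace 𝓘(ℝ, E) x) = 2 * d) (hu : Orthonormal ℝ u)
  (huJ : ∀ i j, ⟪u i, tangentJ E x (u j)⟫_ℝ = 0)
  (hH : (RiemannianBundle.g (E := fun x : M ↦ TangentSpace 𝓘(ℝ, E) x)).IsHermitian)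

include hd hu huJ hH in
/-- **The Kähler form in a unitary frame, graded-form version**: at a point `x` of a complex
manifold with Hermitian metric `g` and unitary frame `u` of `(T_x M, g_x, J_x)`,
`ω_x ⊗ 1 = L 1 = ∑ₐ θₐ ∧ θ'ₐ` (Voisin (2002), §3.1.1: `ω = Σ dxᵢ ∧ dyᵢ`;
`kaehlerTwoForm_eq_sum_wedgeOne`). [cite: Voisin2002, §3.1.1] -/
theorem of_kaehlerForm_ofReal :
    of 2 ((RiemannianBundle.g (E := fun x : M ↦ TangentSpace 𝓘(ℝ, E) x)).kaehlerForm.ofReal x) =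
      frameLef (tangentJ E x) u univ
        (of 0 (constOfIsEmpty ℝ (TangentSpace 𝓘(ℝ, E) x) (Fin 0) (1 : ℂ))) := by
  have hJJ : ∀ v, tangentJ E x (tangentJ E x v) = -v := tangentJ_tangentJ x
  have hJ : ∀ v w, ⟪tangentJ E x v, tangentJ E x w⟫_ℝ = ⟪v, w⟫_ℝ := fun v w ↦ hH x v w
  have hω : ∀ a b, (RiemannianBundle.g (E := fun x : M ↦ TangentSpace 𝓘(ℝ, E) x)).kaehlerForm.ofReal
      x ![a, b] = algebraMap ℝ ℂ ⟪tangentJ E x a, b⟫_ℝ := fun a b ↦ by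
    rw [MForm.ofReal_apply, RiemannianMetric.kaehlerForm_apply_of_isHermitian _ hH,
      Complex.coe_algebraMap]
    rfl
  rw [kaehlerTwoForm_eq_sum_wedgeOne (tangentJ E x) hJJ hJ u hd hu huJ _ hω, of_sum, frameLef,
    lefG_apply]
  refine sum_congr rfl fun i _ ↦ ?_
  rw [wedgeOneG_of, wedgeOneG_of]

include hd hu huJ hH in
/-- **The powers of the Kähler form are `L^r 1`**: `(ω^r)_x ⊗ 1 = L^r 1` (induction on the
recursion `ω^{r+1} = ω^r ∧ ω` of `kaehlerFormPow`, `of_kaehlerForm_ofReal`, and `L` central for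
the wedge). [cite: Voisin2002, §6.2.1] -/
theorem of_kaehlerFormPow_ofReal : ∀ r : ℕ,
    of (2 * r) ((kaehlerFormPow (RiemannianBundle.g (E := fun x : M ↦ TangentSpace 𝓘(ℝ, E) x)) r).ofReal
      x) = (frameLef (tangentJ E x) u univ ^ r)
        (of 0 (constOfIsEmpty ℝ (TangentSpace 𝓘(ℝ, E) x) (Fin 0) (1 : ℂ)))
  | 0 => by
    rw [pow_zero, Module.End.one_apply, kaehlerFormPow_zero, MForm.ofReal_castDeg, of_castDeg_apply]
    congr 1
  | r + 1 => by
    rw [pow_succ', Module.End.mul_apply, ← of_kaehlerFormPow_ofReal r, kaehlerFormPow_succ,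
      MForm.ofReal_castDeg, of_castDeg_apply, MForm.ofReal_wedge, of_wedge_apply,
      of_kaehlerForm_ofReal x u hd hu huJ hH, wedgeG_frameLef_right, wedgeG_one_right]

end Pointwise

/-! ### The pointwise Hodge–Riemann bilinear relation on a Hermitian manifold -/

section PointwiseHR

variable {E : Type*} [NormedAddCommGroup E] [NormedSpace ℂ E] [FiniteDimensional ℂ E]
  {M : Type*} [TopologicalSpace M] [ChartedSpace E M]

/-- **The pointwise Hodge–Riemann bilinear relation at the points of a Hermitian manifold**
(Huybrechts (2005), Cor. 1.2.36, printed p. ≈ 40; Voisin (2002), Prop. 6.29 / Thm. 6.32 at a point), in the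
form consumed by `hodge_riemann_bilinear_of_pointwise`: for a Hermitian metric `g` on a complex
manifold modelled on `E`, `d = dim_ℂ E`, a point `x`, `k + r = d`, and a complex `k`-form `α` whose
value at `x` has weight `p - q` under the rotations `e^{iθ}` of `T_x M` and is `L`-primitive
(`(α ∧ ω^{r+1})_x = 0`), there is `c ≥ 0`, positive when `α_x ≠ 0`, with
`i^{p-q} (-1)^{k(k-1)/2} (α ∧ ᾱ ∧ ω^r)_x = c · (ω^d)_x`. Proof: choose a unitary frame of
`(T_x M, g_x, J_x)` (`exists_unitaryFrame`); in it `(ω^j)_x = L^j 1`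
(`of_kaehlerFormPow_ofReal`), the rotation hypothesis is `HasRotWeight J (p - q)`, primitivity is
`L^{r+1} α_x = 0`, and `Literature.Geometry.Kaehler.hodgeRiemann_frame` applies.
[cite: Huybrechts2005, Cor. 1.2.36] -/
theorem hodgeRiemann_pointwise (g : RiemannianMetric (fun x : M ↦ TangentSpace 𝓘(ℝ, E) x))
    (hg : g.IsHermitian) (y : M) {n p q k r : ℕ} (hkr : k + r = finrank ℂ E)
    (h2d : 2 * finrank ℂ E = n) (h : k + (k + 2 * r) = n) (α : MForm 𝓘(ℝ, E) M ℂ k)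
    (hrot : ∀ (θ : ℝ) (v : Fin k → TangentSpace 𝓘(ℝ, E) y),
      α y (fun i ↦ tangentRotate E y θ (v i)) =
        Complex.exp (((p : ℤ) - q : ℤ) * θ * Complex.I) * α y v)
    (hprim : (α.wedge (kaehlerFormPow g (r + 1)).ofReal) y = 0) :
    ∃ c : ℝ, 0 ≤ c ∧ (α y ≠ 0 → 0 < c) ∧
      ((Complex.I ^ ((p : ℤ) - q) * (-1) ^ (k * (k - 1) / 2)) •
          (α.wedge (α.conj.wedge (kaehlerFormPow g r).ofReal)).castDeg h) y =
        (c : ℂ) • ((kaehlerFormPow g (finrank ℂ E)).castDeg h2d).ofReal y := by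
  letI : RiemannianBundle (fun x : M ↦ TangentSpace 𝓘(ℝ, E) x) := ⟨g⟩
  subst h
  -- the complex structure and a unitary frame of `(T_y M, g_y)`
  have hJJ : ∀ v, tangentJ E y (tangentJ E y v) = -v := tangentJ_tangentJ y
  have hJ : ∀ v w, ⟪tangentJ E y v, tangentJ E y w⟫_ℝ = ⟪v, w⟫_ℝ := fun v w ↦ hg y v w
  obtain ⟨d, u, hd, hu, huJ0⟩ := exists_unitaryFrame (finrank ℝ (TangentSpace 𝓘(ℝ, E) y))
    (TangentSpace 𝓘(ℝ, E) y)
    (tangentJ E y : TangentSpace 𝓘(ℝ, E) y →ₗ[ℝ] TangentSpace 𝓘(ℝ, E) y) hJJ hJ rfl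
  have huJ : ∀ i j, ⟪u i, tangentJ E y (u j)⟫_ℝ = 0 := fun i j ↦ by simpa using huJ0 i j
  have hdC : d = finrank ℂ E := by
    have h1 : finrank ℝ (TangentSpace 𝓘(ℝ, E) y) = 2 * finrank ℂ E := finrank_real_of_complex E
    omega
  subst hdC
  have hH : (RiemannianBundle.g (E := fun x : M ↦ TangentSpace 𝓘(ℝ, E) x)).IsHermitian := hg
  have hΩ : ∀ j : ℕ, of (2 * j) ((kaehlerFormPow g j).ofReal y) = (frameLef (tangentJ E y) u univ ^ j)
      (of 0 (constOfIsEmpty ℝ (TangentSpace 𝓘(ℝ, E) y) (Fin 0) (1 : ℂ))) :=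
    of_kaehlerFormPow_ofReal y u hd hu huJ hH
  -- the value `a = α_y` as a homogeneous graded form: degree, weight, primitivity
  set one : GForm (TangentSpace 𝓘(ℝ, E) y) ℂ :=
    of 0 (constOfIsEmpty ℝ (TangentSpace 𝓘(ℝ, E) y) (Fin 0) (1 : ℂ)) with hone
  set a : GForm (TangentSpace 𝓘(ℝ, E) y) ℂ := of k (α y) with ha
  have hk : IsHomog k a := IsHomog.of k (α y)
  have hw : HasRotWeight (tangentJ E y) ((p : ℤ) - q) a := by
    intro t
    rw [ha, pullG_of, ← of_smul]
    congr 1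
    ext v
    rw [ContinuousAlternatingMap.compContinuousLinearMap_apply, ContinuousAlternatingMap.smul_apply,
      smul_eq_mul, ← hrot t v]
    congr 1
    funext i
    rw [Function.comp_apply, frameRot_apply, tangentRotate_eq_cos_add_sin_tangentJ]
  have hprim' : (frameLef (tangentJ E y) u univ ^ (r + 1)) a = 0 := by
    have h1 : of (k + 2 * (r + 1)) ((α.wedge (kaehlerFormPow g (r + 1)).ofReal) y) = 0 := by
      rw [hprim, of_zero]
    rwa [of_wedge_apply, ← ha, hΩ (r + 1), wedgeG_frameLef_pow_right, wedgeG_one_right] at h1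
  -- the CAR Hodge–Riemann relation, read back on forms
  obtain ⟨c, hc0, hcpos, hHR⟩ :=
    hodgeRiemann_frame (tangentJ E y) hJJ hJ u hd hu huJ hk hw hkr hprim'
  refine ⟨c, hc0, fun hαy ↦ hcpos fun ha0 ↦ hαy (of_eq_zero_iff.1 (ha ▸ ha0)), ?_⟩
  apply of_injective (k + (k + 2 * r))
  rw [MForm.castDeg_rfl, Pi.smul_apply, of_smul, of_wedge_apply, of_wedge_apply, of_conj_apply,
    ← ha, hΩ r, wedgeG_frameLef_pow_right, wedgeG_one_right, wedgeG_frameLef_pow_right, hHR,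
    of_smul, MForm.ofReal_castDeg, of_castDeg_apply, hΩ (finrank ℂ E)]

end PointwiseHR

/-! ### hodge.S15 discharged -/

section Discharge

variable {E : Type*} [NormedAddCommGroup E] [NormedSpace ℂ E] [FiniteDimensional ℂ E]
  {M : Type*} [TopologicalSpace M] [ChartedSpace E M]
  {n : ℕ} [Fact (finrank ℝ E = n)] [MeasurableSpace E] [BorelSpace E] [T2Space M]
  [IsManifold 𝓘(ℝ, E) ∞ M]
  (o : (x : M) → Orientation ℝ (TangentSpace 𝓘(ℝ, E) x) (Fin n))
  (g : ContMDiffRiemannianMetric 𝓘(ℝ, E) ∞ E (fun x : M ↦ TangentSpace 𝓘(ℝ, E) x))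

/-- **hodge.S15 — the Hodge–Riemann bilinear relations** (the named fact
`hodge_riemann_bilinear`, discharged; Huybrechts (2005), Prop. 3.3.15; Voisin (2002), Thm. 6.32):
on a compact connected Kähler manifold, for a non-zero `∂̄`-harmonic `(p,q)`-form `α`,
`k = p + q`, `k + r = dim_ℂ M`, with `α ∧ ω^{r+1} = 0`, the number
`i^{p-q} (-1)^{k(k-1)/2} ∫_M α ∧ ᾱ ∧ ω^r` is real and positive (orientation normalised by
`∫_M ω^d > 0`). Proof = the printed one (Huybrechts, Prop. 3.3.15, printed p. ≈ 139): the pointwise Cor. 1.2.36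
(`hodgeRiemann_pointwise`) plus integration (`hodge_riemann_bilinear_of_pointwise`).
[cite: Huybrechts2005, Prop. 3.3.15] -/
theorem hodge_riemann_bilinear_holds : hodge_riemann_bilinear o g :=
  hodge_riemann_bilinear_of_pointwise o g fun hg x _ _ _ _ hkr h2d h α hrot hprim ↦
    hodgeRiemann_pointwise g.toRiemannianMetric hg x hkr h2d h α hrot hprim

end Discharge

end Literature.AlgebraicGeometry.Motives

end
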